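import Summits.BirchSwinnertonDyer.Rank1Residual.X11b.KummerPoitouTateExact
import Summits.BirchSwinnertonDyer.Rank1Residual.X11b.LocalPrimaryCohomologyEP
import Summits.BirchSwinnertonDyer.BirchSwinnertonDyer.Theorems.ThetaPartnerAtTwoSignedControlAtTwoCasselsArchH2
import HarnessLib

/-!
# Poitou–Tate exactness MODULO THE KUMMER CONDITIONS, at every place including the real ones:
# local classes `(t_v)_{v ∈ S'}` orthogonal to the Selmer classes are `loc_v x` modulo `𝓛_v` for a global `x`
# (the surjectivity mechanism of Cassels' theorem — crux K4, line `eulerchar`, Cassels lane)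

Crux K4 `SignedControlAtTwo` (stmt-BirchSwinnertonDyer-20309; routes `ThetaPartnerAtTwo` /
`ResidualThetaTransportAtTwo`), line `eulerchar` v10, stub `stub_pubGreenbergPTTwo` = {Cassels, Prop. 4.12,
`poitouTate_selmerStructure_duality ℚ`}; width seat `prover-bsd-wall-tp2-p3-w3` g6. This is the variant of the tree's
`SignedEC.CasselsViaPT.exists_mem_kummerOutside_localization_eq_of_inl_mem` (M3, w3 g4) with the STRICT structure
`kummerStrict S'` (exact lifting on `S'`, obstruction against the classes relaxed on `S'`) replaced by the FULL Kummer
structure `kummerStrict ∅ = (𝓛_v)_v` (lifting modulo `𝓛_v`, obstruction only against the SELMER classes) — the shape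
in which Cassels' theorem (Greenberg LNM 1716 Prop. 4.13 / p. 122, `coker(H¹(K_Σ/K, E[p^∞]) → ∏_{v∈Σ} 𝒫_E(K_v)) = 0`)
uses Poitou–Tate: Milne I Thm. 4.10(b) `Ker γ¹ ⊆ Im β¹` for `𝓕 = Kummer ≤ 𝓖 = Kummer relaxed on S'`.

* `kummerStrict_empty_le_kummerRelaxed`, `kummerStrict_empty_apply` — `kummerStrict ∅` is the Kummer structure.
* `map_weilDualInv_mem_kummer_of_mem_dualSelmerGroup_kummer` — the Weil transport `ỹ` of a dual Selmer class `y`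
  for `(kummerStrict ∅)^*` satisfies the Kummer condition at EVERY FINITE place (X11b
  `map_weilDualInv_mem_kummer_of_mem_dualLocalCondition`, `inv_v` injective and Tate's count from `IsPerfect` /
  `natCard_galoisCohomology_one_torsion_adicCompletion_eq_sqEP`) and at every INFINITE place `w` at which `inv_w`
  is injective (sibling `map_weilDualInv_mem_kummer_of_mem_dualLocalCondition_inl`).
* **`exists_mem_kummerOutside_localization_sub_mem`** — for a Poitou–Tate family at level `p^k` (`IsPerfect`,
  `SelmerComplement`), any finite `S'` and local classes `t_v ∈ H¹(K_v, E[p^k])`: IF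
  `∑_{v∈S'} inv_v(t_v ∪ₑ loc_v c) = 0` for every global `c ∈ H¹(K, E[p^k])` that is Kummer at all finite places
  and Kummer at each infinite `w` with `inv_w` injective, THEN `loc_v x − t_v ∈ 𝓛_v` on `S'` for some
  `x ∈ kummerOutside W (p^k) S'` (Kummer outside `S'`).

THEOREMS ONLY (no definition, no named fact, no `sorry`); CONDITIONAL on the displayed properties of the family;
BSD is not proved by any of this.

References: [GreenbergLNM1716] §4 Appendix, Prop. 4.13 and p. 121–122; [MilneADT2006] I Thm. 4.10(b), Lemma
6.15, §6 proof of Prop. 6.9; [Howard2004HeegnerKolyvagin] Thm. 2.1.11.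
-/

set_option autoImplicit false
-- the Theorems namespace of this sub repeats the summit name by design (D-0017 nested layout)
set_option linter.dupNamespace false

noncomputable section

open scoped Classical

open CategoryTheory Field NumberField IsDedekindDomain Function
open Literature.NumberTheory.EllipticCurves Literature.NumberTheory.EllipticCurves.GreenbergSelmer
open Literature.NumberTheory.GaloisRepresentations
open Literature.NumberTheory.GaloisRepresentations.DiscreteGaloisModule (SelmerStructure TateDual
  tateDual localTatePairingZMod unramifiedSubgroup mu MuCarrier)
open Literature.NumberTheory.GaloisCohomology
open scoped ContRepresentation

namespace Summit.BirchSwinnertonDyer.BirchSwinnertonDyer.Theorems.SignedEC.CasselsPT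

open Summit.BirchSwinnertonDyer.Rank1Residual.X11b Summit.BirchSwinnertonDyer.Rank1Residual.X11b.KummerPT
open Summit.BirchSwinnertonDyer.Rank1Residual.X11b.LocBridge
open Summit.BirchSwinnertonDyer.Rank1Residual.X11b.Levels
open Summit.BirchSwinnertonDyer.Rank1Residual.X11b.AcSelmer
open Summit.BirchSwinnertonDyer.Rank1Residual.X11b.FiniteDuality
open Summit.BirchSwinnertonDyer.Rank1Residual.X11b.Relaxation

variable {K : Type} [Field K] [NumberField K] (W : WeierstrassCurve K) [W.IsElliptic] (p k : ℕ)
  [Fact p.Prime]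

/-! ## §1 `kummerStrict ∅` is the Kummer structure -/

section Structures

variable (n : ℕ) (S' : Finset (Place K))

omit [W.IsElliptic] [Fact p.Prime] in
/-- `kummerStrict ∅ v = 𝓛_v` at every place. [folklore] -/
theorem kummerStrict_empty_apply (v : Place K) :
    kummerStrict W n (∅ : Finset (Place K)) v = W.kummerSelmerStructure (n : ℤ) v :=
  kummerStrict_of_not_mem W n ∅ (Finset.notMem_empty v)

omit [W.IsElliptic] [Fact p.Prime] in
/-- `kummerStrict ∅ ≤ kummerRelaxed S'` (`𝓛 ≤ 𝓛` off `S'`, `𝓛 ≤ ⊤` on `S'`): the pair `𝓕 ≤ 𝓖` of Howard Thm. 2.1.11 used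
for Cassels' theorem. [cite: Howard2004HeegnerKolyvagin, Thm. 2.1.11 (arXiv:1202.6340 p. 6)] -/
theorem kummerStrict_empty_le_kummerRelaxed :
    kummerStrict W n (∅ : Finset (Place K)) ≤ kummerRelaxed W n S' := by
  intro v
  rw [kummerStrict_empty_apply]
  by_cases hv : v ∈ S'
  · rw [kummerRelaxed_of_mem W n S' hv]; exact le_top
  · rw [kummerRelaxed_of_not_mem W n S' hv]

end Structures

/-! ## §2 The Weil transport of a dual Selmer class for `(kummerStrict ∅)^*` is Selmer where `inv` is good -/

section LocalDual

variable (n : ℕ) [NeZero n]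
variable (e : W.geomTorsion n → W.geomTorsion n → AlgebraicClosure K)
  (hμ : ∀ S T, e S T ^ n = 1)
  (hadd₁ : ∀ S₁ S₂ T, e (S₁ + S₂) T = e S₁ T * e S₂ T)
  (hadd₂ : ∀ S T₁ T₂, e S (T₁ + T₂) = e S T₁ * e S T₂)
  (hgal : ∀ (σ : absoluteGaloisGroup K) (S T : W.geomTorsion n), σ • e S T = e (σ • S) (σ • T))
  (halt : ∀ T, e T T = 1) (hnondeg : ∀ T, (∀ S, e S T = 1) → T = 0)
  (inv : LocalInvariants K n)

include halt hnondeg in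
/-- **The Weil transport of a dual Selmer class for the full Kummer structure satisfies the Kummer condition at
every finite place and at every infinite place where `inv_w` is injective** (`inv_v` injective and Tate's count
at the finite places): the tree's `map_weilDualInv_mem_kummer_of_mem_dualLocalCondition` / its archimedean twin.
This computes `H¹_{𝓛^*}(K, E[n]^D)`: up to the Weil transport it is `Sel⁽ⁿ⁾(E/K)` — "`S_{M*}(F) = Sel_E(F)_p`",
Greenberg p. 122. [cite: GreenbergLNM1716, §4 Appendix, p. 122] [cite: MilneADT2006, Ch. I §6, proof of Prop. 6.9] -/
theorem map_weilDualInv_mem_kummer_of_mem_dualSelmerGroup_kummer [Finite (W.geomTorsion n)]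
    (hinv : ∀ v : HeightOneSpectrum (𝓞 K), Injective (inv (Sum.inr v)))
    (hEuler : ∀ v : HeightOneSpectrum (𝓞 K),
      Nat.card (galoisCohomology ((W.torsionGaloisModule n).toLocal (Sum.inr v)) 1) =
        (Nat.card (nsmulAddMonoidHom n : (W.baseChange (v.adicCompletion K)).toAffine.Point →+ _).ker *
          Nat.card (v.adicCompletionIntegers K ⧸ Ideal.span {(n : v.adicCompletionIntegers K)})) ^ 2)
    {y : galoisCohomology ((W.torsionGaloisModule n).tateDual n) 1}
    (hy : y ∈ (inv.dualSelmerStructure (W.torsionGaloisModule n)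
      (kummerStrict W n (∅ : Finset (Place K)))).selmerGroup) :
    (∀ v : HeightOneSpectrum (𝓞 K),
      galoisCohomology.localization (W.torsionGaloisModule (n : ℤ)) (Sum.inr v) 1
          (galoisCohomology.map (weilDualInv W n e hμ hadd₁ hadd₂ hgal hnondeg) 1 y) ∈
        W.kummerSelmerStructure (n : ℤ) (Sum.inr v)) ∧
    (∀ w : InfinitePlace K, Injective (inv (Sum.inl w)) →
      galoisCohomology.localization (W.torsionGaloisModule (n : ℤ)) (Sum.inl w) 1
          (galoisCohomology.map (weilDualInv W n e hμ hadd₁ hadd₂ hgal hnondeg) 1 y) ∈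
        W.kummerSelmerStructure (n : ℤ) (Sum.inl w)) := by
  have hyv : ∀ v : Place K, galoisCohomology.localization ((W.torsionGaloisModule n).tateDual n) v 1 y ∈
      inv.dualLocalCondition (W.torsionGaloisModule n) v (W.kummerSelmerStructure (n : ℤ) v) := by
    intro v
    have h := (SelmerStructure.mem_selmerGroup_iff _ y).mp hy v
    rw [LocalInvariants.dualSelmerStructure_apply, kummerStrict_empty_apply] at h
    exact h
  constructor
  · intro v
    rw [localization_map_one]
    exact map_weilDualInv_mem_kummer_of_mem_dualLocalCondition W n e hμ hadd₁ hadd₂ hgal halt hnondeg inv v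
      (hinv v) (hEuler v) (hyv (Sum.inr v))
  · intro w hw
    rw [localization_map_one]
    exact map_weilDualInv_mem_kummer_of_mem_dualLocalCondition_inl W n e hμ hadd₁ hadd₂ hgal halt hnondeg inv w
      hw (hyv (Sum.inl w))

end LocalDual

/-! ## §3 Poitou–Tate exactness modulo the Kummer conditions -/

section Exactness

variable (e : W.geomTorsion ((p ^ k : ℕ) : ℤ) → W.geomTorsion ((p ^ k : ℕ) : ℤ) → AlgebraicClosure K)
  (hμ : ∀ S T, e S T ^ (p ^ k) = 1)
  (hadd₁ : ∀ S₁ S₂ T, e (S₁ + S₂) T = e S₁ T * e S₂ T)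
  (hadd₂ : ∀ S T₁ T₂, e S (T₁ + T₂) = e S T₁ * e S T₂)
  (hgal : ∀ (σ : absoluteGaloisGroup K) (S T : W.geomTorsion ((p ^ k : ℕ) : ℤ)),
    σ • e S T = e (σ • S) (σ • T))
  (halt : ∀ T, e T T = 1) (hnondeg : ∀ T, (∀ S, e S T = 1) → T = 0)

include halt hnondeg in
/-- **POITOU–TATE EXACTNESS MODULO THE KUMMER CONDITIONS (every number field, real places included).** Let
`inv` be a Poitou–Tate family at level `p^k` (`k ≥ 1`) with `IsPerfect` and `SelmerComplement`, `S'` ANY finite set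
of places (infinite places allowed, not required), and `t_v ∈ H¹(K_v, E[p^k])` local classes. Suppose that
`∑_{v∈S'} inv_v(t_v ∪ₑ loc_v c) = 0` for every global class `c ∈ H¹(K, E[p^k])` which satisfies the Kummer condition
at every finite place and at every infinite place `w` at which `inv_w` is injective. Then there is
`x ∈ kummerOutside W (p^k) S'` (Kummer condition outside `S'`) with `loc_v x − t_v ∈ 𝓛_v` for every `v ∈ S'`.
Proof: Howard Thm. 2.1.11 (i) (`SelmerComplement`, from the CITED `poitouTate_selmerStructure_duality`) for
`𝓕 = kummerStrict ∅ = (𝓛_v)_v ≤ 𝓖 = kummerRelaxed S'`, both unramified outside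
`T = S' ∪ {v ∣ p} ∪ {bad v}` (`kummerStrict/Relaxed_isUnramifiedOutside`); the test family `t` extended by `0`
off `S'`; a dual Selmer class `y` for `𝓕^*` has Weil transport `ỹ` of the displayed kind (§2) and
`⟨t_v, loc_v y⟩_v = inv_v(t_v ∪ₑ loc_v ỹ)`; at a finite `v ∈ T ∖ S'` the term is `⟨0, ·⟩ = 0`. This is the way
Poitou–Tate enters Cassels' theorem: Greenberg, LNM 1716, Prop. 4.13 / p. 121 («the cokernel of `γ` … is dual to
a subgroup of `S_{M*}(F)`»). [cite: GreenbergLNM1716, §4 Appendix, Prop. 4.13 and p. 121]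
[cite: Howard2004HeegnerKolyvagin, Thm. 2.1.11 (arXiv:1202.6340 p. 6)] [cite: MilneADT2006, Ch. I, Thm. 4.10(b)] -/
theorem exists_mem_kummerOutside_localization_sub_mem (hk : 0 < k)
    {inv : LocalInvariants K (p ^ k)} (hperf : inv.IsPerfect) (hcompl : inv.SelmerComplement)
    (S' : Finset (Place K))
    (t : Π v : Place K, galoisCohomology ((W.torsionGaloisModule ((p ^ k : ℕ) : ℤ)).toLocal v) 1)
    (ht : ∀ c : galoisCohomology (W.torsionGaloisModule ((p ^ k : ℕ) : ℤ)) 1,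
      (∀ v : HeightOneSpectrum (𝓞 K),
        galoisCohomology.localization (W.torsionGaloisModule ((p ^ k : ℕ) : ℤ)) (Sum.inr v) 1 c ∈
          W.kummerSelmerStructure ((p ^ k : ℕ) : ℤ) (Sum.inr v)) →
      (∀ w : InfinitePlace K, Injective (inv (Sum.inl w)) →
        galoisCohomology.localization (W.torsionGaloisModule ((p ^ k : ℕ) : ℤ)) (Sum.inl w) 1 c ∈
          W.kummerSelmerStructure ((p ^ k : ℕ) : ℤ) (Sum.inl w)) →
      ∑ v ∈ S', invWeilPairing W (p ^ k) e hμ hadd₁ hadd₂ hgal inv v (t v)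
        (galoisCohomology.localization (W.torsionGaloisModule ((p ^ k : ℕ) : ℤ)) v 1 c) = 0) :
    ∃ x ∈ kummerOutside W (p ^ k) S', ∀ v ∈ S',
      galoisCohomology.localization (W.torsionGaloisModule ((p ^ k : ℕ) : ℤ)) v 1 x - t v ∈
        W.kummerSelmerStructure ((p ^ k : ℕ) : ℤ) v := by
  classical
  have hprime : p.Prime := Fact.out
  haveI : NeZero (p ^ k) := ⟨pow_ne_zero k hprime.ne_zero⟩
  haveI : Finite (W.geomTorsion ((p ^ k : ℕ) : ℤ)) := finite_geomTorsion_of_neZero W _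
  haveI : CompactSpace (absoluteGaloisGroup K) := absoluteGaloisGroup_compactSpace K
  have hpp : IsPrimePow (p ^ k) := ⟨p, k, hprime.prime, hk, rfl⟩
  have hEuler : ∀ v : HeightOneSpectrum (𝓞 K),
      Nat.card (galoisCohomology ((W.torsionGaloisModule ((p ^ k : ℕ) : ℤ)).toLocal (Sum.inr v)) 1) =
        (Nat.card (nsmulAddMonoidHom (p ^ k) :
            (W.baseChange (v.adicCompletion K)).toAffine.Point →+ _).ker *
          Nat.card (v.adicCompletionIntegers K ⧸
            Ideal.span {((p ^ k : ℕ) : v.adicCompletionIntegers K)})) ^ 2 := fun v ↦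
    natCard_galoisCohomology_one_torsion_adicCompletion_eq_sqEP W v (p ^ k) hpp
  obtain ⟨T, hS'T, hinf, hp, hbad⟩ := exists_exceptional_finset W p S'
  have hMn : ∀ m : W.geomTorsion ((p ^ k : ℕ) : ℤ), (p ^ k) • m = 0 := fun m ↦
    AddSubgroup.torsionBy.nsmul m
  have hTout : ∀ v : HeightOneSpectrum (𝓞 K), (Sum.inr v : Place K) ∉ T →
      ((p ^ k : ℕ) : 𝓞 K) ∉ v.asIdeal ∧
        GaloisRep.IsUnramifiedAt v (W.torsionGaloisModule ((p ^ k : ℕ) : ℤ)) := by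
    intro v hv
    have hpv : ((p : ℕ) : 𝓞 K) ∉ v.asIdeal := fun h ↦ hv (hp v h)
    have hgood : W.HasGoodReductionAt v := by
      by_contra hbad'
      exact hv (hbad v hbad')
    exact ⟨natCast_pow_not_mem p hpv _,
      isUnramifiedAt_torsionGaloisModule W hgood (intCast_pow_not_mem p hpv _)⟩
  -- the test family, extended by zero off `S'`
  set t' : Π v : Place K, galoisCohomology ((W.torsionGaloisModule ((p ^ k : ℕ) : ℤ)).toLocal v) 1 :=
    fun v ↦ if v ∈ S' then t v else 0 with ht'def
  have ht'mem : ∀ v ∈ S', t' v = t v := fun v hv ↦ by rw [ht'def]; exact if_pos hv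
  have ht'not : ∀ v ∉ S', t' v = 0 := fun v hv ↦ by rw [ht'def]; exact if_neg hv
  have ht' : ∀ v ∈ T, t' v ∈ kummerRelaxed W (p ^ k) S' v := by
    intro v _
    by_cases hv : v ∈ S'
    · rw [kummerRelaxed_of_mem W (p ^ k) S' hv]; exact AddSubgroup.mem_top _
    · rw [ht'not v hv]; exact zero_mem _
  -- Poitou–Tate (Howard 2.1.11 (i)) for `kummerStrict ∅ ≤ kummerRelaxed S'`
  obtain ⟨x, hx, hxt⟩ := (hcompl (W.torsionGaloisModule ((p ^ k : ℕ) : ℤ)) hMn T hTout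
    (kummerStrict W (p ^ k) ∅) (kummerRelaxed W (p ^ k) S') (kummerStrict_empty_le_kummerRelaxed W (p ^ k) S')
    (kummerStrict_isUnramifiedOutside W p k ∅ T (Finset.empty_subset T) hinf hp hbad)
    (kummerRelaxed_isUnramifiedOutside W p k S' T hS'T hinf hp hbad)).1 t' ht' (fun y hy ↦ by
      -- the obstruction vanishes
      set yW := galoisCohomology.map (weilDualInv W (p ^ k) e hμ hadd₁ hadd₂ hgal hnondeg) 1 y
        with hyWdef
      have hyW : galoisCohomology.map (weilDualIntertwining W (p ^ k) e hμ hadd₁ hadd₂ hgal) 1 yW = y :=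
        map_weilDual_map_weilDualInv W (p ^ k) e hμ hadd₁ hadd₂ hgal hnondeg y
      have hySel := map_weilDualInv_mem_kummer_of_mem_dualSelmerGroup_kummer W (p ^ k) e hμ hadd₁ hadd₂ hgal
        halt hnondeg inv (fun v ↦ (hperf v).1.1) hEuler hy
      have hterm : ∀ v : Place K,
          localTatePairingZMod (W.torsionGaloisModule ((p ^ k : ℕ) : ℤ)) (p ^ k) v (inv v) (t' v)
            (galoisCohomology.localization
              ((W.torsionGaloisModule ((p ^ k : ℕ) : ℤ)).tateDual (p ^ k)) v 1 y) =
          invWeilPairing W (p ^ k) e hμ hadd₁ hadd₂ hgal inv v (t' v)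
            (galoisCohomology.localization (W.torsionGaloisModule ((p ^ k : ℕ) : ℤ)) v 1 yW) := by
        intro v
        rw [← hyW, localization_map_one, localTatePairingZMod_map_weilDual, invWeilPairing_apply]
      calc ∑ v ∈ T, localTatePairingZMod (W.torsionGaloisModule ((p ^ k : ℕ) : ℤ)) (p ^ k) v (inv v)
              (t' v) (galoisCohomology.localization
                ((W.torsionGaloisModule ((p ^ k : ℕ) : ℤ)).tateDual (p ^ k)) v 1 y)
          = ∑ v ∈ T, invWeilPairing W (p ^ k) e hμ hadd₁ hadd₂ hgal inv v (t' v)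
              (galoisCohomology.localization (W.torsionGaloisModule ((p ^ k : ℕ) : ℤ)) v 1 yW) :=
            Finset.sum_congr rfl fun v _ ↦ hterm v
        _ = ∑ v ∈ S', invWeilPairing W (p ^ k) e hμ hadd₁ hadd₂ hgal inv v (t' v)
              (galoisCohomology.localization (W.torsionGaloisModule ((p ^ k : ℕ) : ℤ)) v 1 yW) := by
            refine (Finset.sum_subset hS'T fun v _ hvS' ↦ ?_).symm
            rw [ht'not v hvS', map_zero, AddMonoidHom.zero_apply]
        _ = ∑ v ∈ S', invWeilPairing W (p ^ k) e hμ hadd₁ hadd₂ hgal inv v (t v)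
              (galoisCohomology.localization (W.torsionGaloisModule ((p ^ k : ℕ) : ℤ)) v 1 yW) :=
            Finset.sum_congr rfl fun v hv ↦ by rw [ht'mem v hv]
        _ = 0 := ht yW hySel.1 hySel.2)
  refine ⟨x, ?_, fun v hv ↦ ?_⟩
  · rw [← selmerGroup_kummerRelaxed W (p ^ k) S']
    exact hx
  · have h := hxt v (hS'T hv)
    rw [kummerStrict_empty_apply, ht'mem v hv] at h
    exact h

end Exactness

end Summit.BirchSwinnertonDyer.BirchSwinnertonDyer.Theorems.SignedEC.CasselsPT

end
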